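import Mathlib
import Summits.Ventures.PercRepro2.TypedRowMin

/-!
# (ROW-MIN) on the all-type-1 instances suffices (blind cell PercRepro2, night-3 g19, 2026-08-28;
`proofs/NIGHT3-CERT.md` §28.8)

The residual of (ROW-23) is row 2′TRI on the instances whose typed edges are ALL of type `1`
(`TypedBasesOne`, `typedBases_of_row23`). On those instances the deletion and the contraction of a
typed edge are again all-type-`1` instances, so (ROW-MIN) restricted to the all-type-`1` world —
`RowMinOne`: `N(g := 1) ≥ min (N(g := 0), N(g := 3))` whenever every typed edge has type `1` —
already gives `TypedBasesOne` by induction on the typed set (`typedBasesOne_of_rowMinOne`), and with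
(ROW-23) the whole row 2′TRI (`typedBases_of_row23_rowMinOne`). In the all-type-`1` world the three
copies carry DISJOINT typed edge sets (the colouring is an ordered partition of `F`): the residual
of (ROW-23) is a statement about disjointly supported copies only. Own work; standard axioms.
-/

namespace Summit.Ventures.PercRepro2

open UnionCluster

namespace CovForm

section Defs

variable {V : Type*} {E : Type*} [Fintype E] [DecidableEq E] {R : Type*} [Field R]
  [LinearOrder R] [IsStrictOrderedRing R]

/-- **(ROW-MIN) on the all-type-`1` instances, a CANDIDATE (not claimed proved)**: with every typed
edge of type `1` and `g ∈ F`, the typed base is at least the typed base with `g` pinned closed or at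
least the typed base with `g` pinned open. -/
def RowMinOne (ends : E → Sym2 V) (o a₁ a₂ a₃ b : V) : Prop :=
  ∀ (F : Finset E) (z : Config E) (τ : E → ℕ) (g : E), g ∈ F → (∀ e ∈ F, τ e = 1) →
    typedCount F z (Function.update τ g 0)
        (K3 ends o a₁ a₂ a₃ b : Config E → Config E → Config E → R) ≤
      typedCount F z τ (K3 ends o a₁ a₂ a₃ b) ∨
    typedCount F z (Function.update τ g 3)
        (K3 ends o a₁ a₂ a₃ b : Config E → Config E → Config E → R) ≤
      typedCount F z τ (K3 ends o a₁ a₂ a₃ b)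

end Defs

namespace Row23Red

open TypedRed OneTyped

section Main

variable {V : Type*} {E : Type*} [Fintype E] [DecidableEq E] {R : Type*} [Field R]
  [LinearOrder R] [IsStrictOrderedRing R]
variable (ends : E → Sym2 V) (o a₁ a₂ a₃ b : V)

omit [IsStrictOrderedRing R] in
/-- (ROW-MIN) implies its all-type-`1` restriction. -/
theorem rowMinOne_of_rowMin (h : RowMin (R := R) ends o a₁ a₂ a₃ b) :
    RowMinOne (R := R) ends o a₁ a₂ a₃ b :=
  fun F z τ g hg h1 => h F z τ g hg (h1 g hg) fun e he => Or.inl (h1 e he)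

omit [IsStrictOrderedRing R] in
/-- **Row 2′TRI on the all-type-`1` instances from (ROW-MIN) there**: every typed edge reduces to its
deletion or its contraction, both all-type-`1` instances with one typed edge fewer. -/
theorem typedBasesOne_of_rowMinOne (hmin : RowMinOne (R := R) ends o a₁ a₂ a₃ b) :
    TypedBasesOne (R := R) ends o a₁ a₂ a₃ b := by
  intro F
  induction F using Finset.strongInduction with
  | H F ih =>
    intro z τ hτ
    rcases Finset.eq_empty_or_nonempty F with rfl | ⟨g, hg⟩
    · rw [typedCount_empty, K3_diag]
    · have hsub := Finset.erase_ssubset hg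
      have hτ' : ∀ e ∈ F.erase g, τ e = 1 := fun e he => hτ e (Finset.mem_of_mem_erase he)
      rcases hmin F z τ g hg hτ with h | h
      · rw [typedCount_update_zero F g hg z τ] at h
        exact le_trans (ih (F.erase g) hsub (Function.update z g false) τ hτ') h
      · rw [typedCount_update_three F g hg z τ] at h
        exact le_trans (ih (F.erase g) hsub (Function.update z g true) τ hτ') h

omit [IsStrictOrderedRing R] in
/-- **Row 2′TRI from (ROW-23) and (ROW-MIN) on the all-type-`1` instances.** -/
theorem typedBases_of_row23_rowMinOne (h23 : Row23 (R := R) ends o a₁ a₂ a₃ b)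
    (hmin : RowMinOne (R := R) ends o a₁ a₂ a₃ b) : TypedBases (R := R) ends o a₁ a₂ a₃ b :=
  typedBases_of_row23 ends o a₁ a₂ a₃ b h23 (typedBasesOne_of_rowMinOne ends o a₁ a₂ a₃ b hmin)

end Main

end Row23Red

end CovForm

end Summit.Ventures.PercRepro2
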